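import Mathlib
import Literature.NumberTheory.Transcendental.SemialgebraicAlgebraicPoints

/-!
# `PlanarK0Injective` (stmt-KontsevichZagierPeriods-9847) — algebraic-area layer, stub `Interval`

Helper of the unconditional algebraic-area layer of the crux
`Summit.KontsevichZagierPeriods.KontsevichZagierPeriods.Theses.SymplecticScissors.PlanarK0Injective`
(route `SymplecticScissors`, line `compiler_modus_ponens`, line lead seat c5).

Target:
`Summits/KontsevichZagierPeriods/KontsevichZagierPeriods/Theorems/SymplecticScissorsPlanarK0InjectiveAlgebraicLayerInterval.lean`.

A preconnected subset `J ⊆ ℝ` of finite positive Lebesgue measure whose copy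
`{z : ℝ¹ | z 0 ∈ J}` is `ℚ`-semialgebraic is an interval with ALGEBRAIC end points: it is order
connected, nonempty (positive measure) and bounded (finite measure), hence squeezed between
`Ioo (sInf J) (sSup J)` and `Icc (sInf J) (sSup J)` with `sInf J < sSup J`; both end points are
boundary points of `J`, i.e. points at which the `ℚ`-semialgebraic set `{z | z 0 ∈ J}` is neither a
neighbourhood nor a co-neighbourhood, so they are algebraic over `ℚ`
(`Literature.NumberTheory.Transcendental.isAlgebraic_of_not_mem_nhds`, Bochnak–Coste–Roy 1998, §2.1).
-/

open MeasureTheory Set Filter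
open scoped Topology
open Literature.NumberTheory.Transcendental Literature.ModelTheory.ExponentialFields

namespace Summit.KontsevichZagierPeriods.SymplecticScissors.PlanarK0InjectiveAlgebraicLayer

/-- A real number at which a set `J ⊆ ℝ` with `ℚ`-semialgebraic copy `{z : ℝ¹ | z 0 ∈ J}` is
neither a neighbourhood nor a co-neighbourhood is algebraic over `ℚ` (pull back along the
continuous diagonal `t ↦ (t)` and apply `isAlgebraic_of_not_mem_nhds`). [folklore] -/
private theorem isAlgebraic_of_not_mem_nhds_real {J : Set ℝ}
    (hsa : IsSemialgebraic ℚ {z : Fin 1 → ℝ | z 0 ∈ J}) {a : ℝ} (h₁ : J ∉ 𝓝 a) (h₂ : Jᶜ ∉ 𝓝 a) :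
    IsAlgebraic ℚ a := by
  have he : Continuous fun t : ℝ => (fun _ : Fin 1 => t) := continuous_pi fun _ => continuous_id
  exact isAlgebraic_of_not_mem_nhds (x := fun _ : Fin 1 => a) hsa
    (fun h => h₁ (he.continuousAt.preimage_mem_nhds h))
    (fun h => h₂ (he.continuousAt.preimage_mem_nhds h))

/-- **A `ℚ`-semialgebraic interval of finite positive length has algebraic ends.** If `J ⊆ ℝ` is
preconnected, of finite and positive Lebesgue measure, and `{z : ℝ¹ | z 0 ∈ J}` is
`ℚ`-semialgebraic, then `Ioo a b ⊆ J ⊆ Icc a b` for some `a < b` algebraic over `ℚ`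
(namely `a = sInf J`, `b = sSup J`, boundary points of a `ℚ`-semialgebraic subset of the line).
[folklore] -/
theorem exists_Ioo_subset_of_isPreconnected {J : Set ℝ} (hJ : IsPreconnected J)
    (hsa : IsSemialgebraic ℚ {z : Fin 1 → ℝ | z 0 ∈ J}) (hfin : volume J ≠ ⊤)
    (hpos : volume J ≠ 0) :
    ∃ a b : ℝ, IsAlgebraic ℚ a ∧ IsAlgebraic ℚ b ∧ a < b ∧ Ioo a b ⊆ J ∧ J ⊆ Icc a b := by
  -- `J` is nonempty (positive measure) and bounded (finite measure)
  have hne : J.Nonempty :=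
    J.eq_empty_or_nonempty.resolve_left fun h => hpos (by rw [h, measure_empty])
  have hb : BddBelow J := by
    by_contra hb
    by_cases ha : BddAbove J
    · exact hfin (top_unique
        (Real.volume_Iio.symm.trans_le (measure_mono (hJ.Iio_csSup_subset hb ha))))
    · exact hfin (by rw [hJ.eq_univ_of_unbounded hb ha, Real.volume_univ])
  have ha : BddAbove J := by
    by_contra ha
    exact hfin (top_unique
      (Real.volume_Ioi.symm.trans_le (measure_mono (hJ.Ioi_csInf_subset hb ha))))
  -- hence squeezed between `Ioo (sInf J) (sSup J)` and `Icc (sInf J) (sSup J)`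
  have hIoo : Ioo (sInf J) (sSup J) ⊆ J := IsConnected.Ioo_csInf_csSup_subset ⟨hne, hJ⟩ hb ha
  have hIcc : J ⊆ Icc (sInf J) (sSup J) := subset_Icc_csInf_csSup hb ha
  have hlt : sInf J < sSup J := by
    refine not_le.1 fun hle => hpos (nonpos_iff_eq_zero.1 ?_)
    calc volume J ≤ volume (Icc (sInf J) (sSup J)) := measure_mono hIcc
      _ = 0 := by rw [Real.volume_Icc, ENNReal.ofReal_eq_zero.2 (sub_nonpos.2 hle)]
  refine ⟨sInf J, sSup J, ?_, ?_, hlt, hIoo, hIcc⟩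
  · -- `sInf J` is a boundary point of `J`
    refine isAlgebraic_of_not_mem_nhds_real hsa (fun h => ?_) (fun h => ?_)
    · obtain ⟨l, hl, hls⟩ := exists_Ioc_subset_of_mem_nhds h ⟨sInf J - 1, sub_one_lt _⟩
      obtain ⟨c, hlc, hc⟩ := exists_between hl
      exact absurd (hIcc (hls ⟨hlc, hc.le⟩)).1 (not_le.2 hc)
    · obtain ⟨u, hu, hus⟩ := exists_Ico_subset_of_mem_nhds h ⟨sSup J, hlt⟩
      obtain ⟨c, hac, hc⟩ := exists_between (lt_min hu hlt)
      exact hus ⟨hac.le, hc.trans_le (min_le_left _ _)⟩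
        (hIoo ⟨hac, hc.trans_le (min_le_right _ _)⟩)
  · -- `sSup J` is a boundary point of `J`
    refine isAlgebraic_of_not_mem_nhds_real hsa (fun h => ?_) (fun h => ?_)
    · obtain ⟨u, hu, hus⟩ := exists_Ico_subset_of_mem_nhds h ⟨sSup J + 1, lt_add_one _⟩
      obtain ⟨c, hbc, hc⟩ := exists_between hu
      exact absurd (hIcc (hus ⟨hbc.le, hc⟩)).2 (not_le.2 hbc)
    · obtain ⟨l, hl, hls⟩ := exists_Ioc_subset_of_mem_nhds h ⟨sInf J, hlt⟩
      obtain ⟨c, hlc, hc⟩ := exists_between (max_lt hl hlt)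
      exact hls ⟨(le_max_left _ _).trans_lt hlc, hc.le⟩
        (hIoo ⟨(le_max_right _ _).trans_lt hlc, hc⟩)

/-! ## Registered anchor -/

/-- **Registered-stub anchor** (binder-explicit form of `exists_Ioo_subset_of_isPreconnected`,
the stub `Interval` of the algebraic-area layer of crux stmt-KontsevichZagierPeriods-9847): a
preconnected `J ⊆ ℝ` of finite positive measure with `ℚ`-semialgebraic copy in `ℝ¹` satisfies
`Ioo a b ⊆ J ⊆ Icc a b` for some algebraic `a < b`. [folklore] -/
theorem helper_algebraicLayer_interval :
    ∀ (J : Set ℝ), IsPreconnected J →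
      Literature.ModelTheory.ExponentialFields.IsSemialgebraic ℚ {z : Fin 1 → ℝ | z 0 ∈ J} →
      MeasureTheory.volume J ≠ ⊤ → MeasureTheory.volume J ≠ 0 →
      ∃ a b : ℝ, IsAlgebraic ℚ a ∧ IsAlgebraic ℚ b ∧ a < b ∧ Set.Ioo a b ⊆ J ∧ J ⊆ Set.Icc a b :=
  fun _ hJ hsa hfin hpos => exists_Ioo_subset_of_isPreconnected hJ hsa hfin hpos

end Summit.KontsevichZagierPeriods.SymplecticScissors.PlanarK0InjectiveAlgebraicLayer
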